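/-
Copyright (c) 2026 the pub-hodgecm-mathlib formalisation cell (harness21).  Prover seat hodgecm-mathlib-LH4-p19 (g2), req620 Track A «(D-RAM) FOUR-FRAME» squad
(STAGE-1b, row (2) of the piece `f_{T₊}`, the (β₂) road (R-36) «PURE-CELL LEDGER»; β₂ sub-dealer LH4-p04 lineage, lane B (RamK), row (L-D♭) «the diagonal cell below the
clean line»; heir LEAD F0P3a-plan (g21) T20-19 «RELATIVE SIGNS, NEVER σ(u)»), 2026-09-04.
-/
import Summits.HodgeConjecture.HodgeConjecture.Theorems.F0P3cDyRamDiagonalCellLetter        -- ★ p861637+p861725 (LH4-p19 (g0)) §1 helpers, §2 `v_normTheta_sub_norm_le`, §4 `v_add_map_le_varpi_pow_mstar_of_datum`; brings ★ p861372 HEAD B, ★ `valueSetMod_smul_xPlus`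
import Summits.HodgeConjecture.HodgeConjecture.Theorems.F0P3cDyRamDiagonalCellCleanRegime   -- ★ p861813 (LH4-p19 (g0)) §1 `exists_fixed_unit_sub_mul_refSkew_le`, §4 `v_map_le_pow_iff`, `exists_eq_pow_mul_map_add`; brings ★ `d_le_succ_t`
import HarnessLib

/-!
# Crux `H413`, line LH4 «(D-RAM) FOUR-FRAME» — STAGE-1b, row (2), the (β₂) road (R-36), lane B, row (L-D♭): «THE LETTER OF THE DIAGONAL CELL BELOW THE CLEAN LINE» — for
# EVERY eigenvalue gap `δ ≥ 1` the census value set of an integral glued vertex over `Λ ∈ D` is `{s_Λ·N(a)}` thickened by `ϖ^m`, with ONE scalar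
# `s_Λ = jE⁻¹ Tr_ρ(μ ∕ D₀(Λ))` that DEPENDS ON THE VERTEX; it is a unit of deep trace, hence `≡ f_Λ·t₊ (mod 𝔭^{m*})` for a `σ`-fixed unit `f_Λ`, and the letter is
# `valueSetMod σ ϖ m* (f_Λ • X₊)` — the per-vertex half of (L-D♭) (the fibre-halving count is the other half)

Cell `hodgecm-mathlib` (D-0151), FLOOR 0, crux item H413 = `stmt-HodgeConjecture-24833`, route of record `HCCMUnconditional`; squad F0∕P3c∕LH4; lane
`--supports stmt-HodgeConjecture-24833 --as helper` (count-neutral; pays NO tier-0 row).  THEOREMS ONLY (no `def`, no instance, no notation, no `sorry`, default heartbeats);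
★-only imports; states NO law; (β₂) stays a HYPOTHESIS.  DATUM-FREE: the plane `(E², H₂)` with `σ`, `|ϖ| = exp(−1)`, block form `block(H₂, h_W)`, `Γ = endoGL (γ₂, u)`,
★ (C1)'s line model `(M, jE, ρ, Θ; φ, lam, h_M)` and ★ p861372's glue∕generator letters (§1–§2); the torus equations and the sheet datum only in §3–§5.

WHY (memo `F0/P3c/LH4/LH4-p19/g0/MECH-LDflat.v1.LH4p19g0.md` 8f57960d §1; ★ p861637 is the CLEAN sub-case).  ★ p861637's HEAD reads the letter of a D-vertex as
`VS((f·h_W) • X₊)` with ONE `σ`-fixed unit `f` for the whole cell — but only under the clean letter `hlam : μ ≡ −jE(f·t₊·(ϖσϖ)^b) (mod 𝔭^{2b+m*})`, which by ★ p861813 needs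
`δ ≥ m* + d − 1 = 3d − 2`.  BELOW THE CLEAN LINE (`1 ≤ δ ≤ 2d − 2`, the balanced regime of (L-D♭)) the depth multiplier `μ = lam − jE u₀₀` is NOT close to `jE(E)`, and the
right reading is the exact one: on the diagonal cell (`|Y| = |D₀|^{1∕2} = |jEϖ|^b`) the value `Tr_ρ(μ·N_Θ(Yζ + jE a) ∕ D₀)` is `jE(aσa)·Tr_ρ(μ ∕ D₀)` up to `𝔭^m` (the cross terms
of the norm form die exactly as in ★ p861637 §2), so the letter is `{s_Λ·N(a) ∣ |a| ≤ 1} + 𝔭^m` with the VERTEX-DEPENDENT scalar `jE s_Λ = Tr_ρ(μ ∕ D₀)`,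
`D₀ = ϖE^b(α − ρα)·Θ(ϖE^b(α − ρα))·h_M·N_Θ(x₀)` (`Λ = x₀·𝒪_b`).  The scalar is a UNIT as soon as `δ ≥ 1` (Gram-primitivity of `Λ` = `|Tr_ρ(h_M N_Θ x₀)| = 1`, and
`Θ ≡ 1` on the residue field of the RamK line), and its trace `s_Λ + σ s_Λ` is DEEP (`≤ |ϖ|^{3d−2}` once `2b ≥ 3d − 2`: `Θμ = −μ∕(lam·jE u₀₀)` from the torus equations
`Θ(lam)·lam = 1`, `u₀₀σu₀₀ = 1`), so ★ p861813 §1 reads `s_Λ ≡ f_Λ·t₊ (mod 𝔭^{m*})` with `f_Λ` a `σ`-fixed unit and the letter is `valueSetMod σ ϖ m* (f_Λ • xPlus σ ϖ d)`: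
by ★ p861154's dictionary the label of the vertex is the norm class of `f_Λ` — a function of `Λ` through `Tr_ρ(μ ∕ D₀(Λ))` only (MECH-LDflat §2: `∝ χ_E(1 − γV(Λ))`).
* §1 `v_normFormTrace_sub_scalar_le_of_diag` — THE ESTIMATE `|Tr_ρ(μ·N_Θ(Yζ + jE a)∕D₀) − jE(aσa)·Tr_ρ(μ∕D₀)| ≤ |jEϖ|^m` (`|Y| ≤ |jEϖ|^b`, `|D₀| = |jEϖ|^{2b}`, `|μ| ≤ |jEϖ|^{2b}`,
  `m ≤ 2b`, the trace letter `htrace` of ★ p861637).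
* §2 HEAD `valueSet_endoGL_sub_one_glued_eq_scalar_normSet_of_diag` — in ★ p861372 HEAD B's frame VERBATIM plus the D-cell letters `hylev`, `hccv`, `hmb`, `htrace` and
  `hμv : |lam − jE u₀₀| ≤ |jEϖ|^{2b}`: for every `s` with `jE s = Tr_ρ(μ∕D₀)` the `ϖ^m`-value set of `Γ − 1` on the vertex is `{z ∣ ∃ |a| ≤ 1, |(ϖ^m)⁻¹(z − s·aσa)| ≤ 1}`.
* §3 `setOf_thicken_scalar_norm_eq_valueSetMod_smul_xPlus` (`|s − f·t₊| ≤ |ϖ^m|` ⇒ the §2 set is `valueSetMod σ ϖ m (f • xPlus σ ϖ d)`),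
  `exists_fixed_unit_setOf_thicken_eq_valueSetMod_smul_xPlus` (E-side, `d` even: a unit scalar of deep trace reads `VS_{m*}(f • X₊)`, ★ p861813 §1), and §4 HEAD′
  `valueSet_endoGL_sub_one_glued_eq_smul_xPlus_of_diag_of_scalar` — the letter is `valueSetMod σ ϖ m (f • xPlus σ ϖ d)` for ANY `f` with `|s − f·t₊| ≤ |ϖ^m|`.
THE SCALAR ITSELF (unit for `δ ≥ 1`, deep trace from the torus equations, hence `∃ f` `σ`-fixed unit with `|s − f·t₊| ≤ |ϖ|^{m*}` at `d` even, `3d − 2 ≤ 2b`) is the sibling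
file `F0P3cDyRamDiagonalCellScalarUnit` (same seat): together, at `m = m*`, ★ p861154's dictionary reads the label of the vertex as the norm class of `f`.
WHAT IS NOT CLAIMED: the COUNT (that the norm class of `f_Λ` is balanced on the populated part of `D` for `2 ≤ δ ≤ 2d − 2` — MECH-LDflat §3, the lattice half proper, next
file of this seat), the shell conditions and the populated∕glued dictionary (LH4-p04's (S4) dictionaries), and anything at `δ = 0` ((L-EQ): there `|s_Λ| < 1` happens).
HONEST LABEL.  Count-neutral lattice algebra; nothing printed is asserted; no census law is stated; `HC_CM` is proved only modulo the 7 printed citations (2 remaining named inputs: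
hLiu418 = `stmt-HodgeConjecture-24832`, h413 = `stmt-HodgeConjecture-24833`) until rung 0 closes.
## References
* [Jacobowitz1962] R. Jacobowitz, *Hermitian forms over local fields*, Amer. J. Math. 84 (1962): §4 (dual lattices, modular components, gluing).
* [Rogawski1990] J. D. Rogawski, *Automorphic Representations of Unitary Groups in Three Variables*, Ann. of Math. Stud. 123 (1990): §4.9 Prop. 4.9.1 (b) p. 55 (the labelled census of `f_{T₊}`), §12.2.
* [Kottwitz1986BaseChangeUnits] R. E. Kottwitz, *Base change for unit elements of Hecke algebras*, Compositio Math. 60 (1986): §1 pp. 240–241.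
* [Serre1979] J.-P. Serre, *Local Fields*, GTM 67 (1979): Ch. I §6 Prop. 18, Ch. III §3 Prop. 7 (trace ideals), Ch. III §6 Prop. 12 (orders), Ch. V §3 Cor. 3 (norm classes of units).
* [LanglandsShelstad1987] R. P. Langlands, D. Shelstad, *On the definition of transfer factors*, Math. Ann. 278 (1987): §1–§3 (κ-signs on a stable class).
-/

set_option autoImplicit false

noncomputable section

namespace Summit.HodgeConjecture.HodgeConjecture.Cruxes.H413.F0P3cDyRamDiagonalCellLetterBalanced

open scoped Valued WithZero Matrix MatrixGroups
open WithZero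
open Literature.NumberTheory.Automorphic Literature.NumberTheory.Automorphic.HermitianLattice Literature.NumberTheory.Automorphic.UnitaryLatticeTree
open Literature.NumberTheory.Automorphic.UnitaryThreeFourFrame (IsRamifiedQuadraticDatum)
open Literature.NumberTheory.LocalFields.WildQuadraticDatum (d_le_succ_t v_eq_one_of_v_mul_map_eq_one)
open Literature.NumberTheory.Rogawski1990
open Summit.HodgeConjecture.HodgeConjecture.Cruxes.H413.F0P3cDyRamToricCensusDefs
open Summit.HodgeConjecture.HodgeConjecture.Cruxes.H413.F0P3cDyRamFourFramePieces
open Summit.HodgeConjecture.HodgeConjecture.Cruxes.H413.F0P3cDyRamDepthFormLineModel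
open Summit.HodgeConjecture.HodgeConjecture.Cruxes.H413.F0P3cDyRamSmulXPlusLabel (valueSetMod_smul_xPlus)
open Summit.HodgeConjecture.HodgeConjecture.Cruxes.H413.F0P3cDyRamDiagonalCellLetter
open Summit.HodgeConjecture.HodgeConjecture.Cruxes.H413.F0P3cDyRamDiagonalCellCleanRegime (exists_fixed_unit_sub_mul_refSkew_le v_map_le_pow_iff v_eq_pow_of_map_eq
  exists_eq_pow_mul_map_add v_varpi_pow_le_pow)

/-! ## §1 The estimate: on the diagonal cell the value is `jE(aσa)·Tr_ρ(μ∕D₀)` up to `𝔭^m` -/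

section Estimate

variable {E M : Type*} [Field E] [Valued E ℤᵐ⁰] [Field M] [Valued M ℤᵐ⁰] {ρ Θ : M →+* M}

/-- **THE ESTIMATE OF (L-D♭)** (★ p861372 HEAD B's letters: `Y` the dual generator, `D₀ = cc(α − ρα)·ΘY`, the value `Tr_ρ(μ·N_Θ(Yζ + jE a)·D₀⁻¹)`).  ON THE DIAGONAL CELL
(`|Y| ≤ |jEϖ|^b`, `|D₀| = |jEϖ|^{2b}`) with `|μ| ≤ |jEϖ|^{2b}`, `m ≤ 2b` and the trace letter `htrace` (`Θ`-traces of `𝔭_M^b` lie in `𝔭^m`): for all `|ζ| ≤ 1`, `|a| ≤ 1`,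
`|Tr_ρ(μ·N_Θ(Yζ + jE a)∕D₀) − jE(aσa)·Tr_ρ(μ∕D₀)| ≤ |jEϖ|^m` — NO clean letter, NO approximation of `μ` by `jE(E)`: `N_Θ(Yζ + jE a) = jE(aσa) + R` with `|R| ≤ |jEϖ|^m`
(★ `v_normTheta_sub_norm_le`) and `jE(aσa)` is `ρ`-fixed. [cite: Jacobowitz1962, §4] [cite: Rogawski1990, §4.9 Prop. 4.9.1 (b) p. 55] [cite: Kottwitz1986BaseChangeUnits, §1 pp. 240–241] -/
theorem v_normFormTrace_sub_scalar_le_of_diag (σ : E →+* E) {ϖ : E} (hϖ1 : Valued.v ϖ ≤ 1)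
    (jE : E →+* M) (hjv : ∀ c, Valued.v (jE c) ≤ 1 ↔ Valued.v c ≤ 1)
    (hρj : ∀ c, ρ (jE c) = jE c) (hvρ : ∀ x, Valued.v (ρ x) = Valued.v x)
    (hΘΘ : ∀ x, Θ (Θ x) = x) (hvΘ : ∀ x, Valued.v (Θ x) = Valued.v x) (hΘj : ∀ c, Θ (jE c) = jE (σ c))
    {Y D₀ : M} {b : ℕ} (hYv : Valued.v Y ≤ Valued.v (jE ϖ) ^ b) (hD₀ : Valued.v D₀ = Valued.v (jE ϖ) ^ (2 * b)) (hD₀0 : D₀ ≠ 0)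
    {m : ℕ} (hmb : m ≤ 2 * b)
    (htrace : ∀ w : M, Valued.v w ≤ Valued.v (jE ϖ) ^ b → Valued.v (w + Θ w) ≤ Valued.v (jE ϖ) ^ m)
    {μ : M} (hμv : Valued.v μ ≤ Valued.v (jE ϖ) ^ (2 * b))
    {ζ : M} (hζ : Valued.v ζ ≤ 1) {a : E} (ha : Valued.v a ≤ 1) :
    Valued.v (μ * ((Y * ζ + jE a) * Θ (Y * ζ + jE a)) / D₀ + ρ (μ * ((Y * ζ + jE a) * Θ (Y * ζ + jE a)) / D₀)
      - jE (a * σ a) * (μ / D₀ + ρ (μ / D₀))) ≤ Valued.v (jE ϖ) ^ m := by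
  have hD₀v0 : Valued.v D₀ ≠ 0 := (Valuation.ne_zero_iff _).2 hD₀0
  set N : M := (Y * ζ + jE a) * Θ (Y * ζ + jE a) with hN
  set R : M := N - jE (a * σ a) with hR
  have hvR : Valued.v R ≤ Valued.v (jE ϖ) ^ m := v_normTheta_sub_norm_le σ hϖ1 jE hjv hΘΘ hvΘ hΘj hYv hmb htrace hζ ha
  -- the algebraic decomposition of the difference: the `jE(aσa)`-part cancels exactly
  have hNR : N = jE (a * σ a) + R := by rw [hR]; ring
  have hdiff : μ * N / D₀ + ρ (μ * N / D₀) - jE (a * σ a) * (μ / D₀ + ρ (μ / D₀)) = μ * R / D₀ + ρ (μ * R / D₀) := by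
    have hsplit : μ * N / D₀ = jE (a * σ a) * (μ / D₀) + μ * R / D₀ := by rw [hNR]; ring
    rw [hsplit, map_add, map_mul ρ (jE (a * σ a)), hρj]
    ring
  rw [hdiff]
  refine v_add_map_le_of_le ρ hvρ ?_
  rw [div_eq_mul_inv, Valuation.map_mul, Valuation.map_mul, map_inv₀, hD₀]
  calc Valued.v μ * Valued.v R * (Valued.v (jE ϖ) ^ (2 * b))⁻¹
      ≤ Valued.v (jE ϖ) ^ (2 * b) * Valued.v (jE ϖ) ^ m * (Valued.v (jE ϖ) ^ (2 * b))⁻¹ := by gcongr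
    _ = Valued.v (jE ϖ) ^ m := by rw [hD₀] at hD₀v0; field_simp

end Estimate

/-! ## §2 HEAD — the letter of an integral glued vertex over the diagonal cell is `{s·N(a)} + 𝔭^m`, `jE s = Tr_ρ(μ∕D₀)` -/

section Head

variable {E M : Type} [Field E] [Valued E ℤᵐ⁰] [Field M] [Valued M ℤᵐ⁰] {ρ Θ : M →+* M} {α : M}

/-- **HEAD — «THE LETTER OF THE DIAGONAL CELL BELOW THE CLEAN LINE IS `{s_Λ·N(a)}`».**  Frame of ★ p861372 HEAD B `valueSet_endoGL_sub_one_glued_eq_normFormSet_of_gen` VERBATIM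
(the plane `(E², H₂)` with `σ`, `|ϖ| = exp(−1)`, block form `H = block(H₂, h_W)`, `Γ = endoGL (γ₂, u)` with `|u₀₀ − 1| ≤ |ϖ^m|`; ★ (C1)'s line model `(M, jE, ρ, Θ; φ, lam, h_M)` with
`ρ ∘ jE = jE`, `Θ ∘ jE = jE ∘ σ`, `ρ, Θ` isometric; an INTEGRAL vertex `L` glued over `(B₂, w₀)` with generator `g₀`, `|g₀ 1|·|ϖ|^b = 1`; the presentation `φ(B₂) = Λ = x₀·𝒪_cc`,
`φ w₀ = Y⁻¹x₀`, `Y = dualGen ρ Θ α cc h_M x₀`) PLUS the letters of the DIAGONAL CELL: `|Y| = |jEϖ|^b`, `|cc(α − ρα)| = |jEϖ|^b`, `m ≤ 2b`, the trace letter `htrace`, and the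
depth `hμv : |lam − jE u₀₀| ≤ |jEϖ|^{2b}` (the (R-sp) token `|μ| = |jEϖ|^{2b}` of the cell `D = (b, b)`).  THEN for every `s : E` with `jE s = Tr_ρ(μ∕D₀)`, `μ = lam − jE u₀₀`,
`D₀ = cc(α − ρα)·ΘY`, the `ϖ^m`-value set of `Γ − 1` on `L` is `{z ∣ ∃ |a| ≤ 1, |(ϖ^m)⁻¹(z − s·aσa)| ≤ 1}` — one scalar PER VERTEX, no clean letter, every `δ`.
[cite: Jacobowitz1962, §4] [cite: Rogawski1990, §4.9 Prop. 4.9.1 (b) p. 55] [cite: Kottwitz1986BaseChangeUnits, §1 pp. 240–241] [cite: LanglandsShelstad1987, §1–§3] -/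
theorem valueSet_endoGL_sub_one_glued_eq_scalar_normSet_of_diag (σ : E →+* E) {ϖ : E} (hϖ : Valued.v ϖ = exp (-1 : ℤ))
    (H₂ : Matrix (Fin 2) (Fin 2) E) (h : E)
    (jE : E →+* M) (hjv : ∀ c, Valued.v (jE c) ≤ 1 ↔ Valued.v c ≤ 1) (hρj : ∀ c, ρ (jE c) = jE c) (hvρ : ∀ x, Valued.v (ρ x) = Valued.v x)
    (hΘΘ : ∀ x, Θ (Θ x) = x) (hvΘ : ∀ x, Valued.v (Θ x) = Valued.v x) (hΘj : ∀ c, Θ (jE c) = jE (σ c))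
    (φ : (Fin 2 → E) →+ M) (hφs : ∀ (c : E) (x : Fin 2 → E), φ (c • x) = jE c * φ x)
    {γ₂ : GL (Fin 2) E} {lam hM : M} (hφγ : ∀ x, φ ((γ₂ : Matrix (Fin 2) (Fin 2) E) *ᵥ x) = lam * φ x) (hhM : hM ≠ 0)
    (hform : ∀ x y, jE (pairing σ H₂ x y) = hM * Θ (φ x) * φ y + ρ (hM * Θ (φ x) * φ y))
    {L : Submodule 𝒪[E] (Fin 3 → E)} {b : ℕ} (hpr : ∀ x ∈ L, Valued.v (x 1) * Valued.v ϖ ^ b ≤ 1)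
    (hint : ∀ y ∈ L, Valued.v (pairing σ (!![H₂ 0 0, 0, H₂ 0 1; 0, h, 0; H₂ 1 0, 0, H₂ 1 1] : Matrix (Fin 3) (Fin 3) E) y y) ≤ 1)
    {B₂ : Submodule 𝒪[E] (Fin 2 → E)} {w₀ : Fin 2 → E} {g₀ : Fin 3 → E}
    (hB : B₂.map ((Matrix.toLin' (!![1, 0; 0, 0; 0, 1] : Matrix (Fin 3) (Fin 2) E)).restrictScalars 𝒪[E]) =
      L ⊓ LinearMap.ker ((LinearMap.proj (1 : Fin 3) : (Fin 3 → E) →ₗ[E] E).restrictScalars 𝒪[E]))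
    (hg₀ : g₀ ∈ L) (hg₀1 : Valued.v (g₀ 1) * Valued.v ϖ ^ b = 1) (hprg : g₀ - Pi.single 1 (g₀ 1) = ![w₀ 0, 0, w₀ 1])
    (u : GL (Fin 1) E) (m : ℕ) (hum : Valued.v ((u : Matrix (Fin 1) (Fin 1) E) 0 0 - 1) ≤ Valued.v (ϖ ^ m))
    {cc x₀ : M} (hcc : cc * (α - ρ α) ≠ 0) (hx₀ : x₀ ≠ 0) {Λ : AddSubgroup M} (hBΛ : B₂.toAddSubgroup.map φ = Λ)
    (hΛx : ∀ x, x ∈ Λ ↔ ∃ ζ, IsOrd ρ α cc ζ ∧ x = x₀ * ζ) (hw₀Y : φ w₀ = (dualGen ρ Θ α cc hM x₀)⁻¹ * x₀)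
    -- the letters of the diagonal cell
    (hylev : Valued.v (dualGen ρ Θ α cc hM x₀) = Valued.v (jE ϖ) ^ b) (hccv : Valued.v (cc * (α - ρ α)) = Valued.v (jE ϖ) ^ b)
    (hmb : m ≤ 2 * b) (htrace : ∀ w : M, Valued.v w ≤ Valued.v (jE ϖ) ^ b → Valued.v (w + Θ w) ≤ Valued.v (jE ϖ) ^ m)
    (hμv : Valued.v (lam - jE ((u : Matrix (Fin 1) (Fin 1) E) 0 0)) ≤ Valued.v (jE ϖ) ^ (2 * b))
    (s : E) (hs : jE s = (lam - jE ((u : Matrix (Fin 1) (Fin 1) E) 0 0)) / (cc * (α - ρ α) * Θ (dualGen ρ Θ α cc hM x₀)) +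
      ρ ((lam - jE ((u : Matrix (Fin 1) (Fin 1) E) 0 0)) / (cc * (α - ρ α) * Θ (dualGen ρ Θ α cc hM x₀)))) :
    {z : E | ∃ y ∈ L, Valued.v ((ϖ ^ m)⁻¹ * (z - pairing σ (!![H₂ 0 0, 0, H₂ 0 1; 0, h, 0; H₂ 1 0, 0, H₂ 1 1] : Matrix (Fin 3) (Fin 3) E) y
        ((((endoGL (γ₂, u) : GL (Fin 3) E) : Matrix (Fin 3) (Fin 3) E) - 1) *ᵥ y))) ≤ 1} =
      {z : E | ∃ a : E, Valued.v a ≤ 1 ∧ Valued.v ((ϖ ^ m)⁻¹ * (z - s * (a * σ a))) ≤ 1} := by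
  rw [valueSet_endoGL_sub_one_glued_eq_normFormSet_of_gen σ hϖ H₂ h jE hjv hΘΘ φ hφs hφγ hhM hform hpr hint hB hg₀ hg₀1 hprg u m hum hcc hx₀ hBΛ hΛx hw₀Y]
  -- names
  set Y : M := dualGen ρ Θ α cc hM x₀ with hYdef
  set D₀ : M := cc * (α - ρ α) * Θ Y with hD₀def
  set μ : M := lam - jE ((u : Matrix (Fin 1) (Fin 1) E) 0 0) with hμdef
  have hvϖ0 : Valued.v ϖ ≠ 0 := by rw [hϖ]; exact WithZero.exp_ne_zero
  have hϖ0 : ϖ ≠ 0 := fun h0 => by rw [h0, map_zero] at hvϖ0; exact hvϖ0 rfl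
  have hϖ1 : Valued.v ϖ ≤ 1 := by rw [hϖ, ← WithZero.exp_zero, WithZero.exp_le_exp]; norm_num
  have hY0 : Y ≠ 0 := by
    rw [hYdef, dualGen_def]; exact mul_ne_zero (mul_ne_zero hhM (mul_ne_zero hx₀ ((map_ne_zero Θ).2 hx₀))) hcc
  have hD₀0 : D₀ ≠ 0 := mul_ne_zero hcc ((map_ne_zero Θ).2 hY0)
  have hD₀ : Valued.v D₀ = Valued.v (jE ϖ) ^ (2 * b) := by
    rw [hD₀def, Valuation.map_mul, hvΘ, hccv, hylev, two_mul, pow_add]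
  -- the two sides, member by member
  ext z
  simp only [Set.mem_setOf_eq]
  have hkey : ∀ (ζ : M) (a : E), IsOrd ρ α cc ζ → Valued.v a ≤ 1 →
      (Valued.v ((jE ϖ ^ m)⁻¹ * (jE z - (μ * ((Y * ζ + jE a) * Θ (Y * ζ + jE a)) / D₀ + ρ (μ * ((Y * ζ + jE a) * Θ (Y * ζ + jE a)) / D₀)))) ≤ 1 ↔
        Valued.v ((ϖ ^ m)⁻¹ * (z - s * (a * σ a))) ≤ 1) := by
    intro ζ a hζ ha
    have hest := v_normFormTrace_sub_scalar_le_of_diag σ hϖ1 jE hjv hρj hvρ hΘΘ hvΘ hΘj (le_of_eq hylev) hD₀ hD₀0 hmb htrace hμv hζ.1 ha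
    set V : M := μ * ((Y * ζ + jE a) * Θ (Y * ζ + jE a)) / D₀ + ρ (μ * ((Y * ζ + jE a) * Θ (Y * ζ + jE a)) / D₀) with hV
    have hmain : jE (s * (a * σ a)) = jE (a * σ a) * (μ / D₀ + ρ (μ / D₀)) := by rw [map_mul, hs]; ring
    have hsplit : V = jE (s * (a * σ a)) + (V - jE (a * σ a) * (μ / D₀ + ρ (μ / D₀))) := by rw [hmain]; ring
    rw [hsplit, v_inv_mul_sub_add_le_one_iff (pow_ne_zero _ ((map_ne_zero jE).2 hϖ0)) (by rw [Valuation.map_pow]; exact hest),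
      ← v_thicken_iff_map jE hjv]
  constructor
  · rintro ⟨ζ, a, hζ, ha, hz⟩
    exact ⟨a, ha, (hkey ζ a hζ ha).1 hz⟩
  · rintro ⟨a, ha, hz⟩
    exact ⟨0, a, isOrd_zero ρ α cc, ha, (hkey 0 a (isOrd_zero ρ α cc) ha).2 hz⟩

end Head

/-! ## §3 E-side reading: the thickening absorbs `s − f·t₊` -/

section Reading

variable {K : Type} [Field K] [Valued K ℤᵐ⁰] {σ : K →+* K} {ϖ : K} {d t : ℕ}

/-- **THE THICKENING ABSORBS `s − f·t₊`**: if `|s − f·t₊| ≤ |ϖ^m|` (`t₊ = (ϖ − σϖ)((ϖσϖ)^{(d − d%2)∕2})⁻¹`, `ϖ ≠ 0`) then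
`{z ∣ ∃ |a| ≤ 1, |(ϖ^m)⁻¹(z − s·aσa)| ≤ 1} = valueSetMod σ ϖ m (f • xPlus σ ϖ d)` (★ `valueSetMod_smul_xPlus` + ★ `v_inv_mul_sub_add_le_one_iff`).
[cite: Jacobowitz1962, §4] [cite: Serre1979, Ch. V §3 Cor. 3] -/
theorem setOf_thicken_scalar_norm_eq_valueSetMod_smul_xPlus (hvσ : ∀ a, Valued.v (σ a) = Valued.v a) (hϖ0 : ϖ ≠ 0) (m : ℕ) {s f : K}
    (hsf : Valued.v (s - f * ((ϖ - σ ϖ) * ((ϖ * σ ϖ) ^ ((d - d % 2) / 2))⁻¹)) ≤ Valued.v (ϖ ^ m)) :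
    {z : K | ∃ a : K, Valued.v a ≤ 1 ∧ Valued.v ((ϖ ^ m)⁻¹ * (z - s * (a * σ a))) ≤ 1} = valueSetMod σ ϖ m (f • xPlus σ ϖ d) := by
  rw [valueSetMod_smul_xPlus]
  ext z
  simp only [Set.mem_setOf_eq]
  refine exists_congr fun a => and_congr_right fun ha => ?_
  set tp : K := (ϖ - σ ϖ) * ((ϖ * σ ϖ) ^ ((d - d % 2) / 2))⁻¹ with htp
  have hsplit : s * (a * σ a) = f * (tp * (a * σ a)) + (s - f * tp) * (a * σ a) := by ring
  have hsmall : Valued.v ((s - f * tp) * (a * σ a)) ≤ Valued.v (ϖ ^ m) := by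
    rw [Valuation.map_mul, Valuation.map_mul, hvσ]
    calc Valued.v (s - f * tp) * (Valued.v a * Valued.v a) ≤ Valued.v (ϖ ^ m) * (1 * 1) := by gcongr
      _ = Valued.v (ϖ ^ m) := by rw [mul_one, mul_one]
  rw [hsplit, v_inv_mul_sub_add_le_one_iff (pow_ne_zero _ hϖ0) hsmall]

/-- **THE E-SIDE READING OF THE SCALAR** (★ p861813 §1 `exists_fixed_unit_sub_mul_refSkew_le` + `setOf_thicken_scalar_norm_eq_valueSetMod_smul_xPlus`): at a sheet datum with `d`
EVEN, a unit scalar `s` of deep trace (`|s + σs| ≤ |ϖ|^{3d−2}`) has a `σ`-fixed unit `f` with `|s − f·t₊| ≤ |ϖ|^{m*}`, and then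
`{z ∣ ∃ |a| ≤ 1, |(ϖ^{m*})⁻¹(z − s·aσa)| ≤ 1} = valueSetMod σ ϖ m* (f • xPlus σ ϖ d)` — the class of the letter is the norm class of `f` (★ p861154).
[cite: Serre1979, Ch. I §6 Prop. 18] [cite: Serre1979, Ch. V §3 Cor. 3] [cite: Rogawski1990, §4.9 Prop. 4.9.1 (b) p. 55] -/
theorem exists_fixed_unit_setOf_thicken_eq_valueSetMod_smul_xPlus (hD : IsRamifiedQuadraticDatum σ ϖ d t) (hd2 : d % 2 = 0)
    {s : K} (hs1 : Valued.v s = 1) (hstr : Valued.v (s + σ s) ≤ Valued.v ϖ ^ (3 * d - 2)) :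
    ∃ f : K, σ f = f ∧ Valued.v f = 1 ∧ Valued.v (s - f * ((ϖ - σ ϖ) * ((ϖ * σ ϖ) ^ ((d - d % 2) / 2))⁻¹)) ≤ Valued.v ϖ ^ mstarOfRecord d ∧
      {z : K | ∃ a : K, Valued.v a ≤ 1 ∧ Valued.v ((ϖ ^ mstarOfRecord d)⁻¹ * (z - s * (a * σ a))) ≤ 1} =
        valueSetMod σ ϖ (mstarOfRecord d) (f • xPlus σ ϖ d) := by
  have hϖ := hD.2.2.1
  have hvϖ0 : Valued.v ϖ ≠ 0 := by rw [hϖ]; exact exp_ne_zero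
  have hϖ0 : ϖ ≠ 0 := fun h0 => by rw [h0, map_zero] at hvϖ0; exact hvϖ0 rfl
  obtain ⟨f, hσf, hf1, hsf⟩ := exists_fixed_unit_sub_mul_refSkew_le hD hd2 hs1 hstr
  refine ⟨f, hσf, hf1, hsf, setOf_thicken_scalar_norm_eq_valueSetMod_smul_xPlus hD.2.1 hϖ0 _ ?_⟩
  rw [Valuation.map_pow]; exact hsf

end Reading

/-! ## §4 HEAD′ — the letter of a D-vertex is `valueSetMod σ ϖ m (f • X₊)` for any `f ≡ s_Λ∕t₊ (mod ϖ^m)` -/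

section Assembled

variable {E M : Type} [Field E] [Valued E ℤᵐ⁰] [Field M] [Valued M ℤᵐ⁰] {ρ Θ : M →+* M} {α : M}

/-- **HEAD′ — «THE LETTER OF THE DIAGONAL CELL IS `f_Λ • X₊`».**  HEAD `valueSet_endoGL_sub_one_glued_eq_scalar_normSet_of_diag`'s frame VERBATIM, and ANY
scalar `f` with `|s − f·t₊| ≤ |ϖ^m|`: the `ϖ^m`-value set of `Γ − 1` on the vertex is `valueSetMod σ ϖ m (f • xPlus σ ϖ d)`.  With `f` a `σ`-fixed UNIT (sibling `F0P3cDyRamDiagonalCellScalarUnit.exists_scalar_fixed_unit_of_diag_of_gap`) and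
`m = m*`, ★ p861154 `valueSetMod_smul_xPlus_eq_plus_iff_exists_norm` reads the label of the vertex as the norm class of `f`.
[cite: Jacobowitz1962, §4] [cite: Rogawski1990, §4.9 Prop. 4.9.1 (b) p. 55] [cite: Kottwitz1986BaseChangeUnits, §1 pp. 240–241] [cite: LanglandsShelstad1987, §1–§3] -/
theorem valueSet_endoGL_sub_one_glued_eq_smul_xPlus_of_diag_of_scalar (σ : E →+* E) (hvσ : ∀ a, Valued.v (σ a) = Valued.v a) {ϖ : E} (hϖ : Valued.v ϖ = exp (-1 : ℤ))
    (H₂ : Matrix (Fin 2) (Fin 2) E) (h : E) (d : ℕ)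
    (jE : E →+* M) (hjv : ∀ c, Valued.v (jE c) ≤ 1 ↔ Valued.v c ≤ 1) (hρj : ∀ c, ρ (jE c) = jE c) (hvρ : ∀ x, Valued.v (ρ x) = Valued.v x)
    (hΘΘ : ∀ x, Θ (Θ x) = x) (hvΘ : ∀ x, Valued.v (Θ x) = Valued.v x) (hΘj : ∀ c, Θ (jE c) = jE (σ c))
    (φ : (Fin 2 → E) →+ M) (hφs : ∀ (c : E) (x : Fin 2 → E), φ (c • x) = jE c * φ x)
    {γ₂ : GL (Fin 2) E} {lam hM : M} (hφγ : ∀ x, φ ((γ₂ : Matrix (Fin 2) (Fin 2) E) *ᵥ x) = lam * φ x) (hhM : hM ≠ 0)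
    (hform : ∀ x y, jE (pairing σ H₂ x y) = hM * Θ (φ x) * φ y + ρ (hM * Θ (φ x) * φ y))
    {L : Submodule 𝒪[E] (Fin 3 → E)} {b : ℕ} (hpr : ∀ x ∈ L, Valued.v (x 1) * Valued.v ϖ ^ b ≤ 1)
    (hint : ∀ y ∈ L, Valued.v (pairing σ (!![H₂ 0 0, 0, H₂ 0 1; 0, h, 0; H₂ 1 0, 0, H₂ 1 1] : Matrix (Fin 3) (Fin 3) E) y y) ≤ 1)
    {B₂ : Submodule 𝒪[E] (Fin 2 → E)} {w₀ : Fin 2 → E} {g₀ : Fin 3 → E}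
    (hB : B₂.map ((Matrix.toLin' (!![1, 0; 0, 0; 0, 1] : Matrix (Fin 3) (Fin 2) E)).restrictScalars 𝒪[E]) =
      L ⊓ LinearMap.ker ((LinearMap.proj (1 : Fin 3) : (Fin 3 → E) →ₗ[E] E).restrictScalars 𝒪[E]))
    (hg₀ : g₀ ∈ L) (hg₀1 : Valued.v (g₀ 1) * Valued.v ϖ ^ b = 1) (hprg : g₀ - Pi.single 1 (g₀ 1) = ![w₀ 0, 0, w₀ 1])
    (u : GL (Fin 1) E) (m : ℕ) (hum : Valued.v ((u : Matrix (Fin 1) (Fin 1) E) 0 0 - 1) ≤ Valued.v (ϖ ^ m))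
    {cc x₀ : M} (hcc : cc * (α - ρ α) ≠ 0) (hx₀ : x₀ ≠ 0) {Λ : AddSubgroup M} (hBΛ : B₂.toAddSubgroup.map φ = Λ)
    (hΛx : ∀ x, x ∈ Λ ↔ ∃ ζ, IsOrd ρ α cc ζ ∧ x = x₀ * ζ) (hw₀Y : φ w₀ = (dualGen ρ Θ α cc hM x₀)⁻¹ * x₀)
    (hylev : Valued.v (dualGen ρ Θ α cc hM x₀) = Valued.v (jE ϖ) ^ b) (hccv : Valued.v (cc * (α - ρ α)) = Valued.v (jE ϖ) ^ b)
    (hmb : m ≤ 2 * b) (htrace : ∀ w : M, Valued.v w ≤ Valued.v (jE ϖ) ^ b → Valued.v (w + Θ w) ≤ Valued.v (jE ϖ) ^ m)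
    (hμv : Valued.v (lam - jE ((u : Matrix (Fin 1) (Fin 1) E) 0 0)) ≤ Valued.v (jE ϖ) ^ (2 * b))
    (s : E) (hs : jE s = (lam - jE ((u : Matrix (Fin 1) (Fin 1) E) 0 0)) / (cc * (α - ρ α) * Θ (dualGen ρ Θ α cc hM x₀)) +
      ρ ((lam - jE ((u : Matrix (Fin 1) (Fin 1) E) 0 0)) / (cc * (α - ρ α) * Θ (dualGen ρ Θ α cc hM x₀))))
    (f : E) (hsf : Valued.v (s - f * ((ϖ - σ ϖ) * ((ϖ * σ ϖ) ^ ((d - d % 2) / 2))⁻¹)) ≤ Valued.v (ϖ ^ m)) :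
    {z : E | ∃ y ∈ L, Valued.v ((ϖ ^ m)⁻¹ * (z - pairing σ (!![H₂ 0 0, 0, H₂ 0 1; 0, h, 0; H₂ 1 0, 0, H₂ 1 1] : Matrix (Fin 3) (Fin 3) E) y
        ((((endoGL (γ₂, u) : GL (Fin 3) E) : Matrix (Fin 3) (Fin 3) E) - 1) *ᵥ y))) ≤ 1} =
      valueSetMod σ ϖ m (f • xPlus σ ϖ d) := by
  have hvϖ0 : Valued.v ϖ ≠ 0 := by rw [hϖ]; exact exp_ne_zero
  have hϖ0 : ϖ ≠ 0 := fun h0 => by rw [h0, map_zero] at hvϖ0; exact hvϖ0 rfl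
  rw [valueSet_endoGL_sub_one_glued_eq_scalar_normSet_of_diag σ hϖ H₂ h jE hjv hρj hvρ hΘΘ hvΘ hΘj φ hφs hφγ hhM hform hpr hint hB hg₀ hg₀1 hprg u m hum hcc hx₀ hBΛ
    hΛx hw₀Y hylev hccv hmb htrace hμv s hs]
  exact setOf_thicken_scalar_norm_eq_valueSetMod_smul_xPlus hvσ hϖ0 m hsf

end Assembled

end Summit.HodgeConjecture.HodgeConjecture.Cruxes.H413.F0P3cDyRamDiagonalCellLetterBalanced

end
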